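import Literature.NumberTheory.Transcendental.PiTranscendenceMeasure
import Literature.NumberTheory.DiophantineApproximation.IntegerPolynomialRootDistance
import HarnessLib

/-!
# Nesterenko–Waldschmidt 1996, Theorem 2(2) (transcendence measure of `π`): the reduction to
# Theorem 2(1) (measure of algebraic approximation of `π`)

Yu. V. Nesterenko, M. Waldschmidt, *On the approximation of the values of exponential function
and logarithm by algebraic numbers*, Mat. Zapiski 2 (1996) 23–42 (= arXiv:math/0002047), §1.
The paper deduces its Theorem 2(2) — the named fact
`Literature.NumberTheory.Transcendental.NesterenkoWaldschmidt1996_thm_2_2` of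
`PiTranscendenceMeasure.lean` — from its Theorem 2(1),
*"Let `ξ` be a real algebraic number, `d = deg ξ`, `L(ξ) ≤ L`, `L ≥ 3`. Then
`|π − ξ| ≥ exp{−1.2·10⁶ d (log L + d log d)(1 + log d)}"*, in one sentence (p. 2): *"The second
assertion follows from the first one and Lemma 1"*, Lemma 1 being Fel'dman's passage from a
measure of algebraic approximation to a transcendence measure ([F 1982], Lemma 3.7):
*"Let `θ ∈ ℂ`. Assume that for any algebraic number `ξ` with `deg ξ = d` and `L(ξ) = L`, the
inequality `|θ − ξ| ≥ e^{−dφ(d,L)}` holds, where `φ(x,y)` is an increasing function of all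
arguments. Then for any non-zero polynomial `P ∈ ℤ[x]` with `deg P = N` and `L(P) = M`, we have
`|P(θ)| ≥ e^{−dφ(N, 2^N M)} · (4L√N)^{−N}`."*

This file PROVES that deduction (no definitions, no named facts):

* `NesterenkoWaldschmidt1996.transcendenceMeasure_of_approximationMeasure` — Lemma 1 in the
  form `|P(θ)| ≥ exp{−d (φ(d, 2^d L) + log(2dL))}` for `P ≠ 0`, `deg P ≤ d`, `L(P) ≤ L`,
  `L ≥ 3`, `d ≥ 1`, from the hypothesis `|θ − ξ| ≥ exp{−deg(ξ) φ(deg ξ, L')}` for every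
  algebraic `ξ` (complex) and every `L' ≥ max(3, L(ξ))`, `φ ≥ 0` increasing in its first
  argument.  Proof: decompose `P` into irreducible factors in `ℤ[X]`
  (`WfDvdMonoid.induction_on_irreducible`); for an irreducible factor `Q` of degree `n ≥ 1`,
  Gel'fond's inequality `L(Q) ≤ 2ⁿ M(Q)` (Mathlib's `norm_coeff_le_choose_mul_mahlerMeasure`)
  and `M(Q) ≤ M(P) ≤ L(P)` (multiplicativity of the Mahler measure, `M ≥ 1` on `ℤ[X] ∖ 0`)
  give `L(Q) ≤ 2^d L`, and Bugeaud's Lemma A.8 with `ℓ = 1`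
  (`Literature.NumberTheory.DiophantineApproximation.norm_sub_root_pow_le`, already in the tree)
  gives `|Q(θ)| ≥ |θ − α| / (2ⁿ n^{n/2} M(Q)ⁿ)` for the root `α` of `Q` nearest to `θ` when
  `|Q(θ)| ≤ 1`; the junk factor `(2dL)^{−n}` replaces the printed `(4L√N)^{−N}`.
* `NesterenkoWaldschmidt1996_thm_2_2_of_part1` — **Theorem 2(2) from Theorem 2(1)**: the
  hypothesis is Theorem 2(1) for all *complex* algebraic `ξ` (the paper's derivation of 2(1) from
  its Main Theorem, with `θ = πi`, `α = −1`, `β = iξ`, never uses that `ξ` is real, and Lemma 1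
  needs all complex conjugates), with "`ξ` algebraic, `d = deg ξ`, `L(ξ)`" rendered as in
  `Literature.NumberTheory.DiophantineApproximation.Bugeaud2004_thm_8_11`: an irreducible
  `Q ∈ ℤ[X]` of positive degree vanishing at `ξ` (`= ±` the minimal polynomial of `ξ` over `ℤ`),
  `d = deg Q`, `L(ξ) = L(Q) = Σ |coeff|`.  The numerical step is
  `1.2·10⁶ (log(2^d L) + d log d)(1 + log d) + log(2dL) ≤ 2·10⁶ (log L + d log d)(1 + log d)`
  for `d ≥ 1`, `L ≥ 3` (cases `d = 1`, `d = 2`, `d ≥ 3`).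

What is NOT here: Theorem 2(1) itself (it follows from the paper's Main Theorem, Thm 1, a
quantitative Hermite–Lindemann bound proved with interpolation determinants; not in the tree).

## References
* [NesterenkoWaldschmidt1996] Yu. V. Nesterenko, M. Waldschmidt, Mat. Zapiski 2 (1996) 23–42,
  Lemma 1 and Theorem 2 (arXiv:math/0002047, pp. 2–3).
* [Bugeaud2004] Y. Bugeaud, *Approximation by Algebraic Numbers*, CUP 2004, Lemma A.8.
* N. I. Fel'dman, *Hilbert's seventh problem*, Moscow State Univ. 1982, Lemma 3.7.
-/

noncomputable section

open Polynomial Finset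

namespace Literature.NumberTheory.Transcendental

namespace NesterenkoWaldschmidt1996

open Literature.NumberTheory.DiophantineApproximation

/-! ### Length and Mahler measure of an integer polynomial -/

/-- The `ℓ¹`-sum of the complex coefficients of `P ∈ ℤ[X]` is its length `L(P) = Σ_{k ≤ deg P} |a_k|`.
[folklore] -/
theorem sum_norm_coeff_map_eq_length (P : ℤ[X]) :
    ((P.map (Int.castRingHom ℂ)).sum fun _ a => ‖a‖) =
      ((∑ k ∈ Finset.range (P.natDegree + 1), |P.coeff k| : ℤ) : ℝ) := by
  have hinj : Function.Injective (Int.castRingHom ℂ) := Int.cast_injective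
  rw [Polynomial.sum_def, support_map_of_injective P hinj]
  push_cast
  have h : ∀ k, ‖(P.map (Int.castRingHom ℂ)).coeff k‖ = |(P.coeff k : ℝ)| := by
    intro k
    rw [coeff_map, eq_intCast, Complex.norm_intCast]
  simp_rw [h]
  refine Finset.sum_subset (supp_subset_range_natDegree_succ) ?_
  intro k _ hk
  rw [notMem_support_iff.mp hk]
  simp

/-- `M(P) ≤ L(P)` for `P ∈ ℤ[X]` (Mathlib's `mahlerMeasure_le_sum_norm_coeff`). [folklore] -/
theorem mahlerMeasure_le_length (P : ℤ[X]) :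
    (P.map (Int.castRingHom ℂ)).mahlerMeasure ≤
      ((∑ k ∈ Finset.range (P.natDegree + 1), |P.coeff k| : ℤ) : ℝ) := by
  rw [← sum_norm_coeff_map_eq_length]
  exact mahlerMeasure_le_sum_norm_coeff _

/-- **Gel'fond's inequality** `L(Q) ≤ 2^{deg Q} M(Q)` for `Q ∈ ℤ[X]`
(from `|a_k| ≤ (deg Q choose k) M(Q)`). [folklore] -/
theorem length_le_two_pow_mul_mahlerMeasure (Q : ℤ[X]) :
    ((∑ k ∈ Finset.range (Q.natDegree + 1), |Q.coeff k| : ℤ) : ℝ) ≤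
      2 ^ Q.natDegree * (Q.map (Int.castRingHom ℂ)).mahlerMeasure := by
  have hinj : Function.Injective (Int.castRingHom ℂ) := Int.cast_injective
  set q := Q.map (Int.castRingHom ℂ) with hq
  have hnq : q.natDegree = Q.natDegree := natDegree_map_eq_of_injective hinj Q
  push_cast
  have h : ∀ k, |(Q.coeff k : ℝ)| = ‖q.coeff k‖ := by
    intro k
    rw [hq, coeff_map, eq_intCast, Complex.norm_intCast]
  simp_rw [h]
  calc ∑ k ∈ Finset.range (Q.natDegree + 1), ‖q.coeff k‖
      ≤ ∑ k ∈ Finset.range (Q.natDegree + 1), ((Q.natDegree.choose k : ℕ) : ℝ) * q.mahlerMeasure := by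
        refine Finset.sum_le_sum fun k _ => ?_
        have := norm_coeff_le_choose_mul_mahlerMeasure k q
        rwa [hnq] at this
    _ = (∑ k ∈ Finset.range (Q.natDegree + 1), ((Q.natDegree.choose k : ℕ) : ℝ)) * q.mahlerMeasure := by
        rw [Finset.sum_mul]
    _ = 2 ^ Q.natDegree * q.mahlerMeasure := by
        congr 1
        exact_mod_cast Nat.sum_range_choose Q.natDegree

/-- `M(Q) ≤ M(P)` when `Q ∣ P ≠ 0` in `ℤ[X]` (the cofactor has Mahler measure `≥ 1`). [folklore] -/
theorem mahlerMeasure_le_of_dvd {Q P : ℤ[X]} (hP : P ≠ 0) (h : Q ∣ P) :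
    (Q.map (Int.castRingHom ℂ)).mahlerMeasure ≤ (P.map (Int.castRingHom ℂ)).mahlerMeasure := by
  obtain ⟨R, rfl⟩ := h
  have hR : R ≠ 0 := right_ne_zero_of_mul hP
  rw [Polynomial.map_mul, mahlerMeasure_mul]
  have h1 := one_le_mahlerMeasure_of_ne_zero hR
  calc (Q.map (Int.castRingHom ℂ)).mahlerMeasure = (Q.map (Int.castRingHom ℂ)).mahlerMeasure * 1 := by
        ring
    _ ≤ _ := by gcongr; exact mahlerMeasure_nonneg _

/-- An irreducible `Q ∈ ℤ[X]` of positive degree is separable over `ℂ`. [folklore] -/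
theorem separable_map_of_irreducible {Q : ℤ[X]} (hQ : Irreducible Q) (hn : 0 < Q.natDegree) :
    (Q.map (Int.castRingHom ℂ)).Separable := by
  have hprim : Q.IsPrimitive := hQ.isPrimitive (by omega)
  have hirr : Irreducible (Q.map (Int.castRingHom ℚ)) :=
    (hprim.irreducible_iff_irreducible_map_fraction_map (K := ℚ)).mp hQ
  have hsep : (Q.map (Int.castRingHom ℚ)).Separable := hirr.separable
  rw [map_intCast_complex_eq_map_map]
  exact hsep.map

/-! ### Lemma 1 (Fel'dman): from a measure of algebraic approximation to a transcendence measure -/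

/-- **Lemma 1, one irreducible factor.** Let `θ ∈ ℂ` satisfy `|θ − ξ| ≥ exp{−deg(ξ) φ(deg ξ, L')}`
for every algebraic `ξ` and every `L' ≥ max(3, L(ξ))` (`φ ≥ 0` increasing in the degree). If
`P ≠ 0`, `deg P ≤ d`, `L(P) ≤ L`, `L ≥ 3`, `d ≥ 1` and `Q` is an irreducible factor of `P` of
degree `n ≥ 1`, then `|Q(θ)| ≥ exp{−n (φ(d, 2^d L) + log(2dL))}`: indeed `L(Q) ≤ 2ⁿ M(Q) ≤ 2^d L`
(Gel'fond; `M(Q) ≤ M(P) ≤ L(P)`), and for the root `α` of `Q` nearest to `θ`, Bugeaud's Lemma A.8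
(`ℓ = 1`) gives `|θ − α| ≤ 2ⁿ n^{n/2} M(Q)ⁿ |Q(θ)| ≤ (2dL)ⁿ |Q(θ)|` when `|Q(θ)| ≤ 1`.
[cite: NesterenkoWaldschmidt1996, Lemma 1] -/
theorem factor_lower_bound (θ : ℂ) (φ : ℕ → ℕ → ℝ)
    (hφ_nonneg : ∀ n L, 0 ≤ φ n L)
    (hφ_mono : ∀ n d L, n ≤ d → φ n L ≤ φ d L)
    (happrox : ∀ (Q : ℤ[X]) (ξ : ℂ) (L : ℕ), Irreducible Q → 0 < Q.natDegree → aeval ξ Q = 0 →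
      (∑ k ∈ Finset.range (Q.natDegree + 1), |Q.coeff k|) ≤ (L : ℤ) → 3 ≤ L →
      Real.exp (-(Q.natDegree * φ Q.natDegree L)) ≤ ‖θ - ξ‖)
    {P : ℤ[X]} (hP : P ≠ 0) {d L : ℕ} (hd : 1 ≤ d) (hdeg : P.natDegree ≤ d)
    (hlen : (∑ k ∈ Finset.range (P.natDegree + 1), |P.coeff k|) ≤ (L : ℤ)) (hL : 3 ≤ L)
    {Q : ℤ[X]} (hQ : Irreducible Q) (hn : 0 < Q.natDegree) (hQP : Q ∣ P) :
    Real.exp (-(Q.natDegree * (φ d (2 ^ d * L) + Real.log (2 * d * L)))) ≤ ‖aeval θ Q‖ := by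
  set n := Q.natDegree with hndef
  set q := Q.map (Int.castRingHom ℂ) with hq
  have hinj : Function.Injective (Int.castRingHom ℂ) := Int.cast_injective
  have hQ0 : Q ≠ 0 := hQ.ne_zero
  have hq0 : q ≠ 0 := (Polynomial.map_ne_zero_iff hinj).mpr hQ0
  have hnq : q.natDegree = n := natDegree_map_eq_of_injective hinj Q
  have hnd : n ≤ d := (natDegree_le_of_dvd hQP hP).trans hdeg
  have hd1 : (1 : ℝ) ≤ d := by exact_mod_cast hd
  have hL3 : (3 : ℝ) ≤ L := by exact_mod_cast hL
  set J : ℝ := 2 * d * L with hJ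
  have hJ1 : 1 ≤ J := by rw [hJ]; nlinarith
  have hJ0 : 0 < J := one_pos.trans_le hJ1
  set φd := φ d (2 ^ d * L) with hφd
  have hφd0 : 0 ≤ φd := hφ_nonneg _ _
  have hn0 : (0 : ℝ) ≤ n := Nat.cast_nonneg _
  -- Mahler measure bounds: `M(Q) ≤ M(P) ≤ L(P) ≤ L`
  have hMQ : q.mahlerMeasure ≤ L := by
    calc q.mahlerMeasure ≤ (P.map (Int.castRingHom ℂ)).mahlerMeasure := mahlerMeasure_le_of_dvd hP hQP
      _ ≤ ((∑ k ∈ Finset.range (P.natDegree + 1), |P.coeff k| : ℤ) : ℝ) := mahlerMeasure_le_length P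
      _ ≤ L := by exact_mod_cast hlen
  have hMQ0 : 0 ≤ q.mahlerMeasure := mahlerMeasure_nonneg _
  -- `L(Q) ≤ 2^d L`
  have hlenQ : (∑ k ∈ Finset.range (Q.natDegree + 1), |Q.coeff k|) ≤ ((2 ^ d * L : ℕ) : ℤ) := by
    have h1 := length_le_two_pow_mul_mahlerMeasure Q
    have h2 : (2 : ℝ) ^ Q.natDegree * q.mahlerMeasure ≤ 2 ^ d * L := by
      have : (2 : ℝ) ^ Q.natDegree ≤ 2 ^ d := pow_le_pow_right₀ (by norm_num) hnd
      exact mul_le_mul this hMQ hMQ0 (by positivity)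
    have h3 : ((∑ k ∈ Finset.range (Q.natDegree + 1), |Q.coeff k| : ℤ) : ℝ) ≤ ((2 ^ d * L : ℕ) : ℝ) := by
      have e : ((2 ^ d * L : ℕ) : ℝ) = 2 ^ d * (L : ℝ) := by push_cast; ring
      rw [e]; exact h1.trans h2
    exact_mod_cast h3
  -- a root `α` of `q` nearest to `θ`
  have hsep : q.Separable := separable_map_of_irreducible hQ hn
  have hsplit : q.Splits := IsAlgClosed.splits q
  have hcard : q.roots.card = n := by rw [← hnq]; exact (hsplit.natDegree_eq_card_roots).symm
  have hne : q.roots.toFinset.Nonempty := by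
    rw [Multiset.toFinset_nonempty, ne_eq, ← Multiset.card_eq_zero, hcard]; omega
  obtain ⟨α, hαmem, hmin⟩ := q.roots.toFinset.exists_min_image (fun β => ‖θ - β‖) hne
  rw [Multiset.mem_toFinset] at hαmem
  have hmin' : ∀ β ∈ q.roots, ‖θ - α‖ ≤ ‖θ - β‖ := fun β hβ => hmin β (Multiset.mem_toFinset.mpr hβ)
  have hαroot : aeval α Q = 0 := by
    have h := (mem_roots hq0).mp hαmem
    rw [IsRoot.def] at h
    rw [aeval_def, algebraMap_int_eq, ← eval_map]
    exact h
  -- the approximation hypothesis at `ξ = α`, `L' = 2^d L`, and `φ(n, ·) ≤ φ(d, ·)`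
  have h3' : 3 ≤ 2 ^ d * L := le_trans hL (Nat.le_mul_of_pos_left L (by positivity))
  have happ := happrox Q α (2 ^ d * L) hQ hn hαroot hlenQ h3'
  have hexp1 : Real.exp (-(n * φd)) ≤ ‖θ - α‖ := by
    refine le_trans ?_ happ
    apply Real.exp_le_exp.mpr
    have := hφ_mono n d (2 ^ d * L) hnd
    nlinarith
  -- `exp(−n K) · Jⁿ = exp(−n φd)`
  have hK : Real.exp (-(n * (φd + Real.log J))) * J ^ n = Real.exp (-(n * φd)) := by
    rw [show -(n * (φd + Real.log J)) = -(n * φd) + n * (-Real.log J) by ring, Real.exp_add,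
      Real.exp_nat_mul, mul_assoc, ← mul_pow, Real.exp_neg (Real.log J), Real.exp_log hJ0,
      inv_mul_cancel₀ hJ0.ne', one_pow, mul_one]
  by_cases hsmall : ‖aeval θ Q‖ ≤ 1
  swap
  · push Not at hsmall
    refine le_trans ?_ hsmall.le
    rw [Real.exp_le_one_iff]
    have : 0 ≤ Real.log J := Real.log_nonneg hJ1
    nlinarith
  -- Bugeaud's Lemma A.8 with `ℓ = 1`: `|θ − α|² ≤ 2^{2n} nⁿ M^{2n} |Q(θ)|² ≤ J^{2n} |Q(θ)|²`
  have A8 := norm_sub_root_pow_le Q hn hsep θ α hαmem hmin' hsmall 1 le_rfl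
  have A8' : ‖θ - α‖ ^ 2 ≤ J ^ (2 * n) * ‖aeval θ Q‖ ^ 2 := by
    have e1 : (1 * (1 + 1) : ℕ) = 2 := rfl
    rw [e1, mul_one, ← hq, ← hndef] at A8
    refine A8.trans ?_
    have hnn : (n : ℝ) ^ n ≤ (d : ℝ) ^ (2 * n) := by
      calc (n : ℝ) ^ n ≤ (d : ℝ) ^ n := pow_le_pow_left₀ (Nat.cast_nonneg _) (by exact_mod_cast hnd) n
        _ ≤ (d : ℝ) ^ (2 * n) := pow_le_pow_right₀ hd1 (by omega)
    have hMM : q.mahlerMeasure ^ (2 * n) ≤ (L : ℝ) ^ (2 * n) := pow_le_pow_left₀ hMQ0 hMQ _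
    have : (2 : ℝ) ^ (2 * n) * (n : ℝ) ^ n * q.mahlerMeasure ^ (2 * n) ≤ J ^ (2 * n) := by
      rw [hJ, mul_pow, mul_pow]
      gcongr
    exact mul_le_mul_of_nonneg_right this (by positivity)
  have hsq : (Real.exp (-(n * (φd + Real.log J)))) ^ 2 ≤ ‖aeval θ Q‖ ^ 2 := by
    have h1 : (Real.exp (-(n * φd))) ^ 2 ≤ J ^ (2 * n) * ‖aeval θ Q‖ ^ 2 :=
      (pow_le_pow_left₀ (Real.exp_nonneg _) hexp1 2).trans A8'
    rw [← hK, mul_pow, ← pow_mul, mul_comm n 2, mul_comm (J ^ (2 * n))] at h1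
    exact le_of_mul_le_mul_right h1 (pow_pos hJ0 _)
  exact (pow_le_pow_iff_left₀ (Real.exp_nonneg _) (norm_nonneg _) two_ne_zero).mp hsq

/-- **Lemma 1 (Fel'dman [F 1982], Lemma 3.7; Nesterenko–Waldschmidt 1996, Lemma 1).** Let
`θ ∈ ℂ` satisfy `|θ − ξ| ≥ exp{−deg(ξ) φ(deg ξ, L')}` for every algebraic `ξ` — rendered by an
irreducible `Q ∈ ℤ[X]` of positive degree vanishing at `ξ`, `deg ξ = deg Q`, `L(ξ) = L(Q)` — and
every integer `L' ≥ 3` with `L(ξ) ≤ L'`, where `φ ≥ 0` is increasing in its first argument. Then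
for every non-zero `P ∈ ℤ[X]` with `deg P ≤ d`, `L(P) ≤ L`, `L ≥ 3`, `d ≥ 1`:
`|P(θ)| ≥ exp{−d (φ(d, 2^d L) + log(2dL))}` (printed: `e^{−dφ(N,2^N M)} (4L√N)^{−N}`).
Proof: induction over an irreducible factorisation of `P` in `ℤ[X]` and `factor_lower_bound`.
[cite: NesterenkoWaldschmidt1996, Lemma 1] -/
theorem transcendenceMeasure_of_approximationMeasure (θ : ℂ) (φ : ℕ → ℕ → ℝ)
    (hφ_nonneg : ∀ n L, 0 ≤ φ n L)
    (hφ_mono : ∀ n d L, n ≤ d → φ n L ≤ φ d L)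
    (happrox : ∀ (Q : ℤ[X]) (ξ : ℂ) (L : ℕ), Irreducible Q → 0 < Q.natDegree → aeval ξ Q = 0 →
      (∑ k ∈ Finset.range (Q.natDegree + 1), |Q.coeff k|) ≤ (L : ℤ) → 3 ≤ L →
      Real.exp (-(Q.natDegree * φ Q.natDegree L)) ≤ ‖θ - ξ‖)
    (P : ℤ[X]) (hP : P ≠ 0) (d L : ℕ) (hd : 1 ≤ d) (hdeg : P.natDegree ≤ d)
    (hlen : (∑ k ∈ Finset.range (P.natDegree + 1), |P.coeff k|) ≤ (L : ℤ)) (hL : 3 ≤ L) :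
    Real.exp (-(d * (φ d (2 ^ d * L) + Real.log (2 * d * L)))) ≤ ‖aeval θ P‖ := by
  set K := φ d (2 ^ d * L) + Real.log (2 * d * L) with hK
  have hd1 : (1 : ℝ) ≤ d := by exact_mod_cast hd
  have hL3 : (3 : ℝ) ≤ L := by exact_mod_cast hL
  have hK0 : 0 ≤ K := add_nonneg (hφ_nonneg _ _) (Real.log_nonneg (by nlinarith))
  suffices H : ∀ R : ℤ[X], R ∣ P → Real.exp (-(R.natDegree * K)) ≤ ‖aeval θ R‖ by
    refine le_trans ?_ (H P dvd_rfl)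
    apply Real.exp_le_exp.mpr
    have : (P.natDegree : ℝ) ≤ d := by exact_mod_cast hdeg
    nlinarith
  intro R
  induction R using WfDvdMonoid.induction_on_irreducible with
  | zero => intro h; exact absurd (zero_dvd_iff.mp h) hP
  | unit u hu =>
    intro _
    obtain ⟨r, hr, rfl⟩ := Polynomial.isUnit_iff.mp hu
    rw [natDegree_C, aeval_C, algebraMap_int_eq, eq_intCast, Complex.norm_intCast]
    rcases Int.isUnit_iff.mp hr with h | h <;> simp [h]
  | mul a i ha hi IH =>
    intro hdvd
    have hadvd : a ∣ P := dvd_trans (dvd_mul_left a i) hdvd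
    have hidvd : i ∣ P := dvd_trans (dvd_mul_right i a) hdvd
    rw [natDegree_mul hi.ne_zero ha, map_mul, norm_mul, Nat.cast_add, add_mul, neg_add,
      Real.exp_add]
    refine mul_le_mul ?_ (IH hadvd) (Real.exp_nonneg _) (norm_nonneg _)
    rcases Nat.eq_zero_or_pos i.natDegree with h0 | hpos
    · -- `i` is a non-zero constant (a prime of `ℤ`): `|i(θ)| ≥ 1`
      -- (as `Polynomial.one_le_norm_aeval_of_natDegree_eq_zero` of `GelfondCriterionProofs`)
      rw [h0, Nat.cast_zero, zero_mul, neg_zero, Real.exp_zero]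
      have hc : i.coeff 0 ≠ 0 := by
        intro h
        apply hi.ne_zero
        rw [eq_C_of_natDegree_eq_zero h0, h, C_0]
      rw [eq_C_of_natDegree_eq_zero h0, aeval_C, algebraMap_int_eq, eq_intCast, Complex.norm_intCast]
      exact_mod_cast Int.one_le_abs hc
    · exact factor_lower_bound θ φ hφ_nonneg hφ_mono happrox hP hd hdeg hlen hL hi hpos hidvd

/-! ### The numerical inequality and Theorem 2(2) from Theorem 2(1) -/

/-- `1.2·10⁶ (log(2^d L) + d log d)(1 + log d) + log(2dL) ≤ 2·10⁶ (log L + d log d)(1 + log d)`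
(times `d`) for `d ≥ 1`, `L ≥ 3`; cases `d = 1`, `d = 2`, `d ≥ 3` with `0.6931 < log 2 < 0.6932`,
`log 3 > 1.0986`. [folklore] -/
theorem numerics_thm_2_2 (d L : ℕ) (hd : 1 ≤ d) (hL : 3 ≤ L) :
    (d : ℝ) * (1200000 * (Real.log ((2 : ℝ) ^ d * L) + d * Real.log d) * (1 + Real.log d) +
        Real.log (2 * d * L)) ≤
      2 * 10 ^ 6 * (d : ℝ) * (Real.log L + d * Real.log d) * (1 + Real.log d) := by
  have hd1 : (1 : ℝ) ≤ d := by exact_mod_cast hd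
  have hL3 : (3 : ℝ) ≤ L := by exact_mod_cast hL
  set c := Real.log 2 with hc
  set A := Real.log (L : ℝ) with hA
  set ld := Real.log (d : ℝ) with hld
  have hc1 : 0.6931471803 < c := Real.log_two_gt_d9
  have hc2 : c < 0.6931471808 := Real.log_two_lt_d9
  have hA1 : 1.0986122885 < A := Real.log_three_gt_d9.trans_le (Real.log_le_log (by norm_num) hL3)
  have hld0 : 0 ≤ ld := Real.log_nonneg hd1
  have e1 : Real.log ((2 : ℝ) ^ d * L) = d * c + A := by
    rw [Real.log_mul (by positivity) (by positivity), Real.log_pow]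
  have e2 : Real.log (2 * (d : ℝ) * L) = c + ld + A := by
    rw [Real.log_mul (by positivity) (by positivity), Real.log_mul (by norm_num) (by positivity)]
  rw [e1, e2]
  -- the bracket `B ≥ 0`, then multiply by `d ≥ 0`
  have hB : 0 ≤ (1 + ld) * (800000 * A + 800000 * d * ld - 1200000 * d * c) - c - ld - A := by
    rcases Nat.lt_or_ge d 3 with hlt | hge
    · interval_cases d
      · -- `d = 1`
        have : ld = 0 := by rw [hld]; simp
        rw [this]; norm_num; nlinarith
      · -- `d = 2`
        have : ld = c := by rw [hld, hc]; norm_num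
        rw [this]; norm_num; nlinarith
    · -- `d ≥ 3`: `log d ≥ log 3`
      have hd3 : (3 : ℝ) ≤ d := by exact_mod_cast hge
      have hld3 : 1.0986122885 < ld := Real.log_three_gt_d9.trans_le (Real.log_le_log (by norm_num) hd3)
      have t1 : (47000 : ℝ) ≤ 800000 * ld - 1200000 * c := by nlinarith
      have t2 : (1 + ld) * (800000 * A + 47000 * d) ≤
          (1 + ld) * (800000 * A + 800000 * d * ld - 1200000 * d * c) := by
        apply mul_le_mul_of_nonneg_left _ (by linarith)
        nlinarith
      nlinarith [mul_nonneg hld0 (by linarith : (0 : ℝ) ≤ A), mul_nonneg hld0 (by linarith : (0 : ℝ) ≤ d - 1)]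
  have hd0 : (0 : ℝ) ≤ d := by linarith
  nlinarith [mul_nonneg hd0 hB]

end NesterenkoWaldschmidt1996

open NesterenkoWaldschmidt1996 in
/-- **Nesterenko–Waldschmidt 1996, Theorem 2(2) from Theorem 2(1)** ("The second assertion follows
from the first one and Lemma 1", p. 2). Hypothesis = Theorem 2(1) for every *complex* algebraic `ξ`
of degree `d = deg Q` and length `L(ξ) = L(Q) ≤ L`, `L ≥ 3` (`Q ∈ ℤ[X]` irreducible of positive degree
with `Q(ξ) = 0`): `|π − ξ| ≥ exp{−1.2·10⁶ d (log L + d log d)(1 + log d)}` (the paper prints "real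
algebraic"; its proof from the Main Theorem, `θ = πi`, `α = −1`, `β = iξ`, does not use realness).
Conclusion = the named fact `NesterenkoWaldschmidt1996_thm_2_2`. Proof: Lemma 1
(`transcendenceMeasure_of_approximationMeasure`) and `numerics_thm_2_2`.
[cite: NesterenkoWaldschmidt1996, Thm 2(2)] -/
theorem NesterenkoWaldschmidt1996_thm_2_2_of_part1
    (part1 : ∀ (Q : ℤ[X]) (ξ : ℂ) (L : ℕ), Irreducible Q → 0 < Q.natDegree → aeval ξ Q = 0 →
      (∑ k ∈ Finset.range (Q.natDegree + 1), |Q.coeff k|) ≤ (L : ℤ) → 3 ≤ L →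
      Real.exp (-(1200000 * (Q.natDegree : ℝ) * (Real.log L + Q.natDegree * Real.log Q.natDegree) *
        (1 + Real.log Q.natDegree))) ≤ ‖(Real.pi : ℂ) - ξ‖) :
    NesterenkoWaldschmidt1996_thm_2_2 := by
  intro P d L hP hd hdeg hlen hL
  set φ : ℕ → ℕ → ℝ := fun n L' => 1200000 * (Real.log L' + n * Real.log n) * (1 + Real.log n)
    with hφ
  have hφ_nonneg : ∀ n L', 0 ≤ φ n L' := by
    intro n L'
    have h1 : 0 ≤ Real.log (L' : ℝ) := Real.log_natCast_nonneg L'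
    have h2 : 0 ≤ Real.log (n : ℝ) := Real.log_natCast_nonneg n
    simp only [hφ]
    positivity
  have hφ_mono : ∀ n m L', n ≤ m → φ n L' ≤ φ m L' := by
    intro n m L' hnm
    have h1 : 0 ≤ Real.log (L' : ℝ) := Real.log_natCast_nonneg L'
    have h2 : 0 ≤ Real.log (n : ℝ) := Real.log_natCast_nonneg n
    have h3 : Real.log (n : ℝ) ≤ Real.log (m : ℝ) := by
      rcases Nat.eq_zero_or_pos n with rfl | hn
      · simpa using Real.log_natCast_nonneg m
      · exact Real.log_le_log (by exact_mod_cast hn) (by exact_mod_cast hnm)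
    have h4 : (n : ℝ) ≤ m := by exact_mod_cast hnm
    have h5 : (n : ℝ) * Real.log n ≤ m * Real.log m := mul_le_mul h4 h3 h2 (Nat.cast_nonneg _)
    simp only [hφ]
    gcongr
  have happrox : ∀ (Q : ℤ[X]) (ξ : ℂ) (L' : ℕ), Irreducible Q → 0 < Q.natDegree → aeval ξ Q = 0 →
      (∑ k ∈ Finset.range (Q.natDegree + 1), |Q.coeff k|) ≤ (L' : ℤ) → 3 ≤ L' →
      Real.exp (-(Q.natDegree * φ Q.natDegree L')) ≤ ‖(Real.pi : ℂ) - ξ‖ := by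
    intro Q ξ L' hQ hn hξ hlen' hL'
    have := part1 Q ξ L' hQ hn hξ hlen' hL'
    convert this using 3
    simp only [hφ]
    ring
  have key := transcendenceMeasure_of_approximationMeasure (Real.pi : ℂ) φ hφ_nonneg hφ_mono happrox
    P hP d L hd hdeg hlen hL
  refine le_trans ?_ key
  apply Real.exp_le_exp.mpr
  rw [neg_le_neg_iff]
  have hnum := numerics_thm_2_2 d L hd hL
  simp only [hφ]
  push_cast
  linarith

end Literature.NumberTheory.Transcendental

end
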